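import Mathlib
import HarnessLib
import Summits.NavierStokesRegularity.NavierStokesRegularity.Theorems.UnthreadedDoorAntidynamoWallSteadyCore

/-!
# Route `UnthreadedDoor` / `ThreadingFlux`, crux `PoloidalLiouville` (stmt-NavierStokesRegularity-1222), antidynamo v2 skeleton
# (sha16 `4ebf5683127b`), WALL `stub_scalarLiouville`: RIGIDLY TRANSLATING VORTICITY PATTERNS — trivial unless the pattern is at rest, and then
# the flow is exactly steady

Support file (seat leafhand-ns-unthreadeddoor-2 g1, cell decomp-ns), `--supports stmt-NavierStokesRegularity-1222 --as helper`; theorems only.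

After steady flows, the most natural candidates for a non-trivial bounded ancient flow are TRAVELLING WAVES and, more generally, flows whose vorticity is
a rigid translate of one pattern, `curl v(t, x) = W(x − γ(t))`.  For the wall they are no threat:

* ★★ `curl_eq_zero_of_curl_translating_pattern` — unthreaded about `x₀` at every `t < 0` + `curl v(t) = W(· − γ(t))` with `γ(s) ≠ γ(s')` for two
  negative times ⇒ `curl v ≡ 0` on `(−∞,0) × ℝ³`.  [The pattern `W` is tangent to the spheres about `x₀ − γ(s)` AND about `x₀ − γ(s')`, so
  `γ(s) − γ(s')` is orthogonal to `W` everywhere, hence to every vorticity slice: Z (`CellFlux.zonalUnthreadedVorticityVanishes`).]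
  In particular travelling waves `γ(t) = t • b`, `b ≠ 0`, are irrotational (`curl_eq_zero_of_curl_travellingWave`).
* ★★ `curl_eq_zero_or_steady_of_curl_pattern` — if instead the pattern never moves (`γ` constant) the vorticity is steady and p816327
  (`curl_eq_zero_or_steady_of_curl_steady`) applies: irrotational ∨ the velocity is exactly steady.  Together (`curl_eq_zero_or_steady_of_curl_translate`):
  **a rigidly translating vorticity pattern ⇒ irrotational, or the pattern is at rest and the flow is exactly steady.**

HONEST LABEL: corollaries of Z and p816327; nothing here proves `stub_scalarLiouville`, `PoloidalLiouville` (1222), or bears on Navier–Stokes regularity;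
no summit statement is proved (crux 1222 is INCOMPARABLE with the summit). [folklore]
[cite: KochNadirashviliSereginSverak2009, Thm 5.2 (arXiv:0709.3599 pp. 9–10)]
-/

noncomputable section

-- the summit and its single sub-problem share the name (CONVENTIONS §1)
set_option linter.dupNamespace false

open scoped Topology InnerProductSpace RealInnerProductSpace ContDiff
open Filter Set Function Metric MeasureTheory
open Literature.Analysis.FluidPDE

namespace Summit.NavierStokesRegularity.NavierStokesRegularity.Theorems.PoloidalLiouville.Antidynamo

open Summit.NavierStokesRegularity.NavierStokesRegularity.Theorems.PoloidalLiouville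
  (toroidalPotential exists_norm_curl_le constantOfIrrotational)

/-! ### ★★ A moving pattern is trivial -/

/-- ★★ **A RIGIDLY TRANSLATING VORTICITY PATTERN THAT MOVES IS TRIVIAL.**  Let `v` be a bounded ancient mild solution (`ν = 1`, duality class) with
measurable slices, jointly smooth on `(−∞,0) × ℝ³` and unthreaded about `x₀`.  If `curl v(t, x) = W(x − γ(t))` for all `t < 0`, `x`, and the path
takes two different values `γ(s) ≠ γ(s')` at negative times, then `curl v ≡ 0` on `(−∞,0) × ℝ³`.
[cite: KochNadirashviliSereginSverak2009, Thm 5.2 (arXiv:0709.3599 pp. 9–10)] -/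
theorem curl_eq_zero_of_curl_translating_pattern
    (v : ℝ → EuclideanSpace ℝ (Fin 3) → EuclideanSpace ℝ (Fin 3)) (x₀ : EuclideanSpace ℝ (Fin 3))
    (hB : Literature.Analysis.FluidPDE.IsBoundedAncientMildSolution 1 v)
    (hm : ∀ t < 0, AEStronglyMeasurable (v t) volume)
    (hsm : ContDiffOn ℝ (⊤ : ℕ∞) (Function.uncurry v) (Set.Iio 0 ×ˢ Set.univ))
    (hun : ∀ t < 0, ∀ x, ⟪x - x₀, curl (v t) x⟫ = 0)
    (W : EuclideanSpace ℝ (Fin 3) → EuclideanSpace ℝ (Fin 3)) (γ : ℝ → EuclideanSpace ℝ (Fin 3))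
    (hW : ∀ t < 0, ∀ x, curl (v t) x = W (x - γ t))
    (hmove : ∃ s < 0, ∃ s' < 0, γ s ≠ γ s') :
    ∀ t < 0, ∀ x, curl (v t) x = 0 := by
  obtain ⟨s, hs, s', hs', hne⟩ := hmove
  -- the pattern is tangent to the spheres about `x₀ − γ σ` for every negative `σ`
  have htan : ∀ σ < 0, ∀ z, ⟪z + γ σ - x₀, W z⟫ = 0 := fun σ hσ z => by
    have h := hun σ hσ (z + γ σ)
    rwa [hW σ hσ, add_sub_cancel_right] at h
  -- hence `γ s − γ s'` is orthogonal to the pattern everywhere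
  have hflat : ∀ z, ⟪γ s - γ s', W z⟫ = 0 := fun z => by
    have h1 := htan s hs z
    have h2 := htan s' hs' z
    have e : γ s - γ s' = (z + γ s - x₀) - (z + γ s' - x₀) := by abel
    rw [e, inner_sub_left, h1, h2, sub_zero]
  obtain ⟨K, hK⟩ := exists_norm_curl_le hB hsm
  obtain ⟨T, -, -, hlink⟩ := toroidalPotential v x₀ K hsm hK hun
  exact CellFlux.zonalUnthreadedVorticityVanishes v x₀ T hB hm hsm hlink fun t ht =>
    ⟨γ s - γ s', sub_ne_zero.2 hne, fun x => by rw [hW t ht x]; exact hflat (x - γ t)⟩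

/-- ★★ **TRAVELLING-WAVE VORTICITY IS TRIVIAL**: `curl v(t, x) = W(x − t • b)` with `b ≠ 0` ⇒ `curl v ≡ 0`.
[cite: KochNadirashviliSereginSverak2009, Thm 5.2 (arXiv:0709.3599 pp. 9–10)] -/
theorem curl_eq_zero_of_curl_travellingWave
    (v : ℝ → EuclideanSpace ℝ (Fin 3) → EuclideanSpace ℝ (Fin 3)) (x₀ : EuclideanSpace ℝ (Fin 3))
    (hB : Literature.Analysis.FluidPDE.IsBoundedAncientMildSolution 1 v)
    (hm : ∀ t < 0, AEStronglyMeasurable (v t) volume)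
    (hsm : ContDiffOn ℝ (⊤ : ℕ∞) (Function.uncurry v) (Set.Iio 0 ×ˢ Set.univ))
    (hun : ∀ t < 0, ∀ x, ⟪x - x₀, curl (v t) x⟫ = 0)
    (W : EuclideanSpace ℝ (Fin 3) → EuclideanSpace ℝ (Fin 3)) {b : EuclideanSpace ℝ (Fin 3)} (hb : b ≠ 0)
    (hW : ∀ t < 0, ∀ x, curl (v t) x = W (x - t • b)) :
    ∀ t < 0, ∀ x, curl (v t) x = 0 :=
  curl_eq_zero_of_curl_translating_pattern v x₀ hB hm hsm hun W (fun t => t • b) hW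
    ⟨-1, by norm_num, -2, by norm_num, fun h => hb (by
      have h2 : ((-1 : ℝ) - (-2)) • b = 0 := by rw [sub_smul, h, sub_self]
      norm_num at h2
      exact h2)⟩

/-! ### ★★ A pattern at rest: steady vorticity -/

/-- ★★ **A PATTERN AT REST ⇒ IRROTATIONAL OR EXACTLY STEADY**: `curl v(t, x) = W(x − a)` for a FIXED `a` and all `t < 0` ⇒ the vorticity is steady,
so (p816327) EITHER `curl v ≡ 0` OR `v(s, ·) = v(t, ·)` for all `s, t < 0`. [cite: KochNadirashviliSereginSverak2009, Thm 5.2 (arXiv:0709.3599 pp. 9–10)] -/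
theorem curl_eq_zero_or_steady_of_curl_pattern
    (v : ℝ → EuclideanSpace ℝ (Fin 3) → EuclideanSpace ℝ (Fin 3)) (x₀ : EuclideanSpace ℝ (Fin 3))
    (hB : Literature.Analysis.FluidPDE.IsBoundedAncientMildSolution 1 v)
    (hm : ∀ t < 0, AEStronglyMeasurable (v t) volume)
    (hsm : ContDiffOn ℝ (⊤ : ℕ∞) (Function.uncurry v) (Set.Iio 0 ×ˢ Set.univ))
    (hun : ∀ t < 0, ∀ x, ⟪x - x₀, curl (v t) x⟫ = 0)
    (W : EuclideanSpace ℝ (Fin 3) → EuclideanSpace ℝ (Fin 3)) (a : EuclideanSpace ℝ (Fin 3))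
    (hW : ∀ t < 0, ∀ x, curl (v t) x = W (x - a)) :
    (∀ t < 0, ∀ x, curl (v t) x = 0) ∨ ∀ s < 0, ∀ t < 0, ∀ y, v s y = v t y :=
  curl_eq_zero_or_steady_of_curl_steady v x₀ hB hm hsm hun fun τ hτ t ht x => by
    rw [hW t ht x, hW (t - τ) (by linarith) x]

/-- ★★ **A RIGIDLY TRANSLATING VORTICITY PATTERN ⇒ IRROTATIONAL, OR AT REST AND EXACTLY STEADY.**  If `curl v(t, x) = W(x − γ(t))` for all `t < 0`,
then EITHER `curl v ≡ 0` on `(−∞,0) × ℝ³` OR (`γ` is constant on `(−∞,0)` AND `v(s, ·) = v(t, ·)` for all `s, t < 0`).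
[cite: KochNadirashviliSereginSverak2009, Thm 5.2 (arXiv:0709.3599 pp. 9–10)] -/
theorem curl_eq_zero_or_steady_of_curl_translate
    (v : ℝ → EuclideanSpace ℝ (Fin 3) → EuclideanSpace ℝ (Fin 3)) (x₀ : EuclideanSpace ℝ (Fin 3))
    (hB : Literature.Analysis.FluidPDE.IsBoundedAncientMildSolution 1 v)
    (hm : ∀ t < 0, AEStronglyMeasurable (v t) volume)
    (hsm : ContDiffOn ℝ (⊤ : ℕ∞) (Function.uncurry v) (Set.Iio 0 ×ˢ Set.univ))
    (hun : ∀ t < 0, ∀ x, ⟪x - x₀, curl (v t) x⟫ = 0)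
    (W : EuclideanSpace ℝ (Fin 3) → EuclideanSpace ℝ (Fin 3)) (γ : ℝ → EuclideanSpace ℝ (Fin 3))
    (hW : ∀ t < 0, ∀ x, curl (v t) x = W (x - γ t)) :
    (∀ t < 0, ∀ x, curl (v t) x = 0) ∨
      ((∀ s < 0, ∀ t < 0, γ s = γ t) ∧ ∀ s < 0, ∀ t < 0, ∀ y, v s y = v t y) := by
  by_cases hmove : ∃ s < 0, ∃ s' < 0, γ s ≠ γ s'
  · exact Or.inl (curl_eq_zero_of_curl_translating_pattern v x₀ hB hm hsm hun W γ hW hmove)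
  · push Not at hmove
    have hconst : ∀ s < 0, ∀ t < 0, γ s = γ t := fun s hs t ht => hmove s hs t ht
    have hW' : ∀ t < 0, ∀ x, curl (v t) x = W (x - γ (-1)) := fun t ht x => by
      rw [hW t ht x, hconst t ht (-1) (by norm_num)]
    rcases curl_eq_zero_or_steady_of_curl_pattern v x₀ hB hm hsm hun W (γ (-1)) hW' with h | h
    · exact Or.inl h
    · exact Or.inr ⟨hconst, h⟩

end Summit.NavierStokesRegularity.NavierStokesRegularity.Theorems.PoloidalLiouville.Antidynamo

end
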